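/-
Copyright (c) 2026. All rights reserved.
Released under Apache 2.0 license as described in the file LICENSE.
Authors: abc-iut cell, prover seat abc-iut-L4-t5 (gen 10; row «F3757-PORT», abc-iut-L4-lead m147 (5)), after abc-iut-f-101's
`LogFrobeniusMonoTelecoreObservablesShape.lean` (the mono-analytic twin), over files 1–5 of this mover.
-/
import Literature.AnabelianGeometry.AbsoluteAnabelian.LogFrobeniusAnTelecoreObservablesSinks
import Literature.AnabelianGeometry.AbsoluteAnabelian.LogFrobeniusObservablesTSOfPlus
import Literature.AnabelianGeometry.AbsoluteAnabelian.LogFrobeniusObservablesTelecore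
import HarnessLib

/-!
# [AbsTopIII] Cor 5.5 (iii), last sentence, inside `D_{An•}`: pins — which included paths join the observation vertices

S. Mochizuki, *Topics in absolute anabelian geometry III: global reconstruction algorithms*,
J. Math. Sci. Univ. Tokyo 22 (2015) 939–1156 [MochizukiAbsTopIII2015]; manuscript `paper:url-5493eb38cbb7`, locators read on the
page: Cor 5.5 p. 130 (the rows of `D•`), (iii) p. 131 (`S_log⊞_v` on `D•_{≤2} ∪ {𝒩⊞_v}`, `S_log_v` on `(D•_{≤3})_v ∪ {𝒩_v}`,
`λ_{v,ν}` = `λ⊞_{v,ν}` followed by `𝒩⊞_v → 𝒩_v`), Def 3.5 (i)/(ii) pp. 74–75.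

WHAT (row «F3757-PORT», file 6 of the mover; graph-theoretic bookkeeping for the push-forward axiom of the sinks of `D_{An•}`):
* `eqToHom`/`HEq` bookkeeping and the shape lemma `outerShape_whiskerRight` (an outer homotopy whose observable part is post-whiskered);
* pins: `embPlus w'` meets `𝒩⊞_w` only at its observation vertex with `w' = w` and misses `𝒩_w`, `ℰ•`; `embTS w'` meets `𝒩⊞_w` / `𝒩_w`
  only with `w' = w`, misses `ℰ•`; inside `(D•_{≤3})_w ∪ {𝒩_w}` the only paths out of `𝒩⊞_w` are `𝟙` and `[𝒩⊞_w → 𝒩_w]`; no path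
  leaves an observation vertex (`plusPath_from_obs`, `tsPath_from_obs`);
* the `⊞`-paths pushed along `𝒩⊞_v → 𝒩_v` read in `D_{An•}` (`tsEmb_mapPath_push`, after abc-iut-f-101's `embMonoTS_mapPath_push`);
* the two presentations of each embedding agree (abc-iut-L4-t3's `embPlus`/`embTS`/`embE5` vs file 1's `embObs` instances:
  `embPlus_mapPath_heq`, `embTS_mapPath_heq`, `embE5_mapPath_heq`), and the core-of-(i) diagram at `ℰ•` IS `D_{An•}` pulled back
  (`extendE5_eq_comapAlongAn`).

Pure graph/category bookkeeping; nothing here bears on [IUTchIII] Cor. 3.12; no side taken.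
-/

set_option autoImplicit false

universe u

open CategoryTheory Quiver

namespace Literature.AnabelianGeometry.AbsoluteAnabelian

namespace LogFrobeniusSetting

open DiagramOfCategories

variable {Vmod : Type u} {isArc : Vmod → Bool} (L : LogFrobeniusSetting Vmod isArc)

/-! ## Bookkeeping -/

set_option backward.defeqAttrib.useBackward true in
/-- Components against the functor of the empty path (bookkeeping for Def 3.5 (ii)). [cite: MochizukiAbsTopIII2015, Definition 3.5 (ii) p.75] -/
theorem app_eq_conj_nil_map' {A B : Type*} [Category A] [Category B] {F G : A ⥤ B} (θ : F ⟶ G) (x : A)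
    {I : B ⥤ B} (hI : I = 𝟭 B) (h₁ : F.obj x = I.obj (F.obj x)) (h₂ : I.obj (G.obj x) = G.obj x) :
    θ.app x = eqToHom h₁ ≫ I.map (θ.app x) ≫ eqToHom h₂ := by
  subst hI
  exact (eq_of_heq (DiagramOfCategories.HomotopyFamily.heq_eqToHom_comp_comp_eqToHom h₁ h₂ _)).symm

/-- Equal functors have heterogeneously equal actions (bookkeeping for Def 3.5 (ii)). [cite: MochizukiAbsTopIII2015, Definition 3.5 (ii) p.75] -/
theorem map_heq_of_functor_eq' {A B : Type*} [Category A] [Category B] {F G : A ⥤ B} (h : F = G) {Y Z : A} (f : Y ⟶ Z) :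
    HEq (F.map f) (G.map f) := by
  subst h; rfl

/-- Two morphisms with the same endpoints, each `HEq` to a common one, are equal (bookkeeping for Def 3.5 (ii)).
[cite: MochizukiAbsTopIII2015, Definition 3.5 (ii) p.75] -/
theorem eq_of_heq_of_heq {C : Type*} [Category C] {a b a' b' : C} {f g : a ⟶ b} {k : a' ⟶ b'} (hf : HEq f k) (hg : HEq g k) :
    f = g :=
  eq_of_heq (hf.trans hg.symm)

set_option backward.defeqAttrib.useBackward true in
/-- The outer shape whose observable part is a conjugated post-whiskering IS the post-whiskered outer shape (Def 3.5 (ii), third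
axiom; all functors variable). [cite: MochizukiAbsTopIII2015, Definition 3.5 (ii) p.75] -/
theorem outerShape_whiskerRight {X B N N' : Type*} [Category X] [Category B] [Category N] [Category N'] {S₀ S : X ⥤ B}
    (h : S₀ ⟶ S) {T T' : B ⥤ N} (t : T ⟶ T') (K : N ⥤ N') {TK TK' : B ⥤ N'} (eT : TK = T ⋙ K) (eT' : TK' = T' ⋙ K)
    {tK : TK ⟶ TK'} (etK : tK = eqToHom eT ≫ Functor.whiskerRight t K ≫ eqToHom eT'.symm)
    {P Q : X ⥤ N} (eP : P = S₀ ⋙ T) (eQ : Q = S ⋙ T') {P' Q' : X ⥤ N'} (eP' : P' = S₀ ⋙ TK) (eQ' : Q' = S ⋙ TK')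
    (e₁ : P' = P ⋙ K) (e₂ : Q' = Q ⋙ K) :
    eqToHom eP' ≫ (Functor.whiskerRight h TK ≫ Functor.whiskerLeft S tK) ≫ eqToHom eQ'.symm =
      eqToHom e₁ ≫ Functor.whiskerRight (eqToHom eP ≫ (Functor.whiskerRight h T ≫ Functor.whiskerLeft S t) ≫ eqToHom eQ.symm) K ≫
        eqToHom e₂.symm := by
  subst etK eT eT' eP eQ eP' eQ'
  ext x
  simp

/-! ## Which vertices of the sub-observables coincide; which included paths join them -/

section Pins

variable (w w' : Vmod)

/-- `embPlus w'` hits `𝒩⊞_w` only at its observation vertex, and then `w' = w`. [cite: MochizukiAbsTopIII2015, Cor 5.5 p. 130] -/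
theorem plusEmb_obj_eq_nplus {a₀ : (logShapePlus (isArc := isArc) w').Vertex} {hn : InFive (isArc := isArc) (.nplus w)}
    (h : (plusEmb (Vmod := Vmod) (isArc := isArc) w').obj a₀ = (anShape (Vmod := Vmod) (isArc := isArc)).base ⟨.nplus w, hn⟩) :
    w' = w := by
  rcases a₀ with ⟨c, hc⟩ | _
  · cases h; exact absurd hc.2 (by change ¬ (3 ≤ 2); decide)
  · cases h; rfl

/-- … (same instance) and the vertex is the observation vertex. [cite: MochizukiAbsTopIII2015, Cor 5.5 p. 130] -/
theorem plusEmb_obj_eq_nplus_self {a₀ : (logShapePlus (isArc := isArc) w).Vertex} {hn : InFive (isArc := isArc) (.nplus w)}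
    (h : (plusEmb (Vmod := Vmod) (isArc := isArc) w).obj a₀ = (anShape (Vmod := Vmod) (isArc := isArc)).base ⟨.nplus w, hn⟩) :
    a₀ = (logShapePlus (isArc := isArc) w).obs := by
  rcases a₀ with ⟨c, hc⟩ | _
  · cases h; exact absurd hc.2 (by change ¬ (3 ≤ 2); decide)
  · rfl

/-- `embPlus w'` misses `𝒩_w`. [cite: MochizukiAbsTopIII2015, Cor 5.5 p. 130] -/
theorem plusEmb_obj_ne_nv (a₀ : (logShapePlus (isArc := isArc) w').Vertex) (hn : InFive (isArc := isArc) (.nv w)) :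
    (plusEmb (Vmod := Vmod) (isArc := isArc) w').obj a₀ ≠ (anShape (Vmod := Vmod) (isArc := isArc)).base ⟨.nv w, hn⟩ := by
  rcases a₀ with ⟨c, hc⟩ | _ <;> intro h <;> cases h
  exact absurd hc.2 (by change ¬ (4 ≤ 2); decide)

/-- `embPlus w'` misses `ℰ•`. [cite: MochizukiAbsTopIII2015, Cor 5.5 p. 130] -/
theorem plusEmb_obj_ne_e5 (a₀ : (logShapePlus (isArc := isArc) w').Vertex) (hn : InFive (isArc := isArc) .e5) :
    (plusEmb (Vmod := Vmod) (isArc := isArc) w').obj a₀ ≠ (anShape (Vmod := Vmod) (isArc := isArc)).base ⟨.e5, hn⟩ := by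
  rcases a₀ with ⟨c, hc⟩ | _ <;> intro h <;> cases h
  exact absurd hc.2 (by change ¬ (5 ≤ 2); decide)

/-- `embTS w'` hits `𝒩⊞_w` only as a base vertex, and then `w' = w`. [cite: MochizukiAbsTopIII2015, Cor 5.5 p. 130] -/
theorem tsEmb_obj_eq_nplus {a₀ : (logShapeTS (isArc := isArc) w').Vertex} {hn : InFive (isArc := isArc) (.nplus w)}
    (h : (tsEmb (Vmod := Vmod) (isArc := isArc) w').obj a₀ = (anShape (Vmod := Vmod) (isArc := isArc)).base ⟨.nplus w, hn⟩) :
    w' = w := by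
  rcases a₀ with ⟨c, hc⟩ | _
  · cases h
    rcases hc with hc | hc
    · exact absurd hc.2 (by change ¬ (3 ≤ 2); decide)
    · cases hc; rfl
  · cases h

/-- … (same instance) and the vertex is the base vertex `𝒩⊞_w` of `(D•_{≤3})_w`. [cite: MochizukiAbsTopIII2015, Cor 5.5 p. 130] -/
theorem tsEmb_obj_eq_nplus_self {a₀ : (logShapeTS (isArc := isArc) w).Vertex} {hn : InFive (isArc := isArc) (.nplus w)}
    (h : (tsEmb (Vmod := Vmod) (isArc := isArc) w).obj a₀ = (anShape (Vmod := Vmod) (isArc := isArc)).base ⟨.nplus w, hn⟩) :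
    a₀ = (logShapeTS (isArc := isArc) w).base ⟨.nplus w, nplus_mem_portion w⟩ := by
  rcases a₀ with ⟨c, hc⟩ | _
  · cases h; rfl
  · cases h

/-- `embTS w'` hits `𝒩_w` only at its observation vertex, and then `w' = w`. [cite: MochizukiAbsTopIII2015, Cor 5.5 p. 130] -/
theorem tsEmb_obj_eq_nv {a₀ : (logShapeTS (isArc := isArc) w').Vertex} {hn : InFive (isArc := isArc) (.nv w)}
    (h : (tsEmb (Vmod := Vmod) (isArc := isArc) w').obj a₀ = (anShape (Vmod := Vmod) (isArc := isArc)).base ⟨.nv w, hn⟩) :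
    w' = w := by
  rcases a₀ with ⟨c, hc⟩ | _
  · cases h
    rcases hc with hc | hc
    · exact absurd hc.2 (by change ¬ (4 ≤ 2); decide)
    · cases hc
  · cases h; rfl

/-- … and the vertex is the observation vertex. [cite: MochizukiAbsTopIII2015, Cor 5.5 p. 130] -/
theorem tsEmb_obj_eq_nv_self {a₀ : (logShapeTS (isArc := isArc) w).Vertex} {hn : InFive (isArc := isArc) (.nv w)}
    (h : (tsEmb (Vmod := Vmod) (isArc := isArc) w).obj a₀ = (anShape (Vmod := Vmod) (isArc := isArc)).base ⟨.nv w, hn⟩) :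
    a₀ = (logShapeTS (isArc := isArc) w).obs := by
  rcases a₀ with ⟨c, hc⟩ | _
  · cases h
    rcases hc with hc | hc
    · exact absurd hc.2 (by change ¬ (4 ≤ 2); decide)
    · cases hc
  · rfl

/-- `embTS w'` misses `ℰ•`. [cite: MochizukiAbsTopIII2015, Cor 5.5 p. 130] -/
theorem tsEmb_obj_ne_e5 (a₀ : (logShapeTS (isArc := isArc) w').Vertex) (hn : InFive (isArc := isArc) .e5) :
    (tsEmb (Vmod := Vmod) (isArc := isArc) w').obj a₀ ≠ (anShape (Vmod := Vmod) (isArc := isArc)).base ⟨.e5, hn⟩ := by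
  rcases a₀ with ⟨c, hc⟩ | _ <;> intro h <;> cases h
  rcases hc with hc | hc
  · exact absurd hc.2 (by change ¬ (5 ≤ 2); decide)
  · cases hc

/-- **In `(D•_{≤3})_w ∪ {𝒩_w}` the only paths out of `𝒩⊞_w` are the trivial one and `[𝒩⊞_w → 𝒩_w]`** (no other arrow leaves `𝒩⊞_w`
inside the portion; nothing leaves `𝒩_w`). [cite: MochizukiAbsTopIII2015, Cor 5.5 (iii) p. 131] -/
theorem tsPath_from_nplus {hn : InPortionThree (isArc := isArc) w (.nplus w)} :
    ∀ {y : (logShapeTS (isArc := isArc) w).Vertex} (s : Path ((logShapeTS (isArc := isArc) w).base ⟨.nplus w, hn⟩) y),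
      (∃ _ : y = (logShapeTS (isArc := isArc) w).base ⟨.nplus w, hn⟩,
        HEq s (Path.nil : Path ((logShapeTS (isArc := isArc) w).base ⟨.nplus w, hn⟩) _)) ∨
      (∃ _ : y = (logShapeTS (isArc := isArc) w).obs,
        HEq s ((Path.nil : Path ((logShapeTS (isArc := isArc) w).base ⟨.nplus w, hn⟩) _).cons (forgetEdgeTS (isArc := isArc) w)))
  | _, Path.nil => Or.inl ⟨rfl, HEq.rfl⟩
  | y, Path.cons s e => by
    rcases tsPath_from_nplus s with ⟨rfl, hs⟩ | ⟨rfl, hs⟩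
    · cases hs
      rcases y with ⟨c, hc⟩ | _
      · change DEdge isArc (.nplus w) c at e
        revert hc
        cases e with
        | forget _ => intro hc; exact (ts_hnot w hc).elim
        | monoNplus _ => intro hc; rcases hc with hc | hc <;> [exact hc.1.elim; cases hc]
      · change DEdge isArc (.nplus w) (.nv w) at e
        cases e
        exact Or.inr ⟨rfl, HEq.rfl⟩
    · cases hs
      rcases y with ⟨c, hc⟩ | _ <;> exact (PEmpty.elim e : False).elim

end Pins

/-! ## The `⊞`-paths pushed along `𝒩⊞_v → 𝒩_v`, inside `D_{An•}` -/

section PushPaths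

variable (v : Vmod)

/-- `Path.nil` respects equality of vertices (bookkeeping). [cite: MochizukiAbsTopIII2015, Definition 3.5 (i) p.75] -/
theorem heq_nil {V : Type*} [Quiver V] {a a' : V} (ha : a = a') : HEq (Path.nil : Path a a) (Path.nil : Path a' a') := by
  subst ha; rfl

/-- The two embeddings agree on `Γ⃗(S_log⊞_v) ⊆ Γ⃗(S_log_v)`: vertices. [cite: MochizukiAbsTopIII2015, Cor 5.5 (iii) p. 131] -/
theorem tsEmb_plusToTS_obj (a : (logShapePlus (isArc := isArc) v).Vertex) :
    (tsEmb (Vmod := Vmod) (isArc := isArc) v).obj ((plusToTS v).obj a) = (plusEmb (Vmod := Vmod) (isArc := isArc) v).obj a := by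
  cases a <;> rfl

/-- … and paths (heterogeneously). [cite: MochizukiAbsTopIII2015, Cor 5.5 (iii) p. 131] -/
theorem tsEmb_plusToTS_mapPath_heq {a : (logShapePlus (isArc := isArc) v).Vertex} :
    ∀ {b : (logShapePlus (isArc := isArc) v).Vertex} (p : Path a b),
      HEq ((tsEmb (Vmod := Vmod) (isArc := isArc) v).mapPath ((plusToTS v).mapPath p))
        ((plusEmb (Vmod := Vmod) (isArc := isArc) v).mapPath p)
  | _, Path.nil => heq_nil (tsEmb_plusToTS_obj v a)
  | _, Path.cons (b := b) (c := c) p e => by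
    rw [Prefunctor.mapPath_cons, Prefunctor.mapPath_cons, Prefunctor.mapPath_cons]
    refine heq_cons (tsEmb_plusToTS_obj v a) (tsEmb_plusToTS_obj v b) (tsEmb_plusToTS_obj v c) (tsEmb_plusToTS_mapPath_heq p) ?_
    cases b with
    | obs => cases c <;> exact (PEmpty.elim e)
    | base y =>
      cases c with
      | base z => rfl
      | obs => rfl

/-- The arrow `𝒩⊞_v → 𝒩_v` of `Γ⃗_{D_{An•}}`. [cite: MochizukiAbsTopIII2015, Cor 5.5 p. 130] -/
abbrev forgetArrowAn : (anShape (Vmod := Vmod) (isArc := isArc)).base ⟨.nplus v, nplus_mem_five v⟩ ⟶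
    (anShape (Vmod := Vmod) (isArc := isArc)).base ⟨.nv v, nv_mem_five v⟩ :=
  DEdge.forget v

/-- **A `⊞`-path pushed along `𝒩⊞_v → 𝒩_v`, embedded, is the embedded `⊞`-path followed by the arrow `𝒩⊞_v → 𝒩_v` of `D_{An•}`.**
[cite: MochizukiAbsTopIII2015, Cor 5.5 (iii) p. 131] -/
theorem tsEmb_mapPath_push (x : DSub (DVertex.InFirstRows (isArc := isArc) 2))
    (p : Path ((logShapePlus (isArc := isArc) v).base x) (logShapePlus (isArc := isArc) v).obs) :
    (tsEmb (Vmod := Vmod) (isArc := isArc) v).mapPath (((plusToTS v).mapPath p).cons (forgetEdgeTS v)) =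
      ((plusEmb (Vmod := Vmod) (isArc := isArc) v).mapPath p).comp (edgePath (forgetArrowAn (Vmod := Vmod) (isArc := isArc) v)) := by
  rw [Prefunctor.mapPath_cons]
  exact eq_of_heq (heq_cons (tsEmb_plusToTS_obj v _) rfl rfl (tsEmb_plusToTS_mapPath_heq v p) HEq.rfl)

/-- `D_[𝒩⊞_v → 𝒩_v]` (through the one-edge path) is the functor `𝒩⊞_v → 𝒩_v`. [cite: MochizukiAbsTopIII2015, Definition 3.5 (i) p.75] -/
theorem pathFunctor_forgetArrowAn :
    L.anDiagram.pathFunctor (edgePath (forgetArrowAn (Vmod := Vmod) (isArc := isArc) v)) = L.forget v := by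
  rw [pathFunctor_cons, pathFunctor_nil]
  exact Functor.id_comp _

end PushPaths

/-! ## No path leaves an observation vertex -/

section FromObs

/-- A path of the `⊞`-shape from its observation vertex is trivial. [cite: MochizukiAbsTopIII2015, Definition 3.5 (iii) p.75] -/
theorem plusPath_from_obs (w : Vmod) {y : (logShapePlus (isArc := isArc) w).Vertex}
    (r : Path (logShapePlus (isArc := isArc) w).obs y) :
    ∃ _ : y = (logShapePlus (isArc := isArc) w).obs, HEq r (Path.nil : Path y y) := by
  cases r with
  | nil => exact ⟨rfl, HEq.rfl⟩
  | cons r e =>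
    rename_i b
    rcases b with ⟨c, hc⟩ | _
    · exact (path_obs_base_elim (DVertex.InFirstRows 2) (.nplus w) ⟨c, hc⟩ r).elim
    · cases y <;> exact (PEmpty.elim e : False).elim

/-- A path of the `TS`-shape from its observation vertex is trivial. [cite: MochizukiAbsTopIII2015, Definition 3.5 (iii) p.75] -/
theorem tsPath_from_obs (w : Vmod) {y : (logShapeTS (isArc := isArc) w).Vertex}
    (r : Path (logShapeTS (isArc := isArc) w).obs y) :
    ∃ _ : y = (logShapeTS (isArc := isArc) w).obs, HEq r (Path.nil : Path y y) := by
  cases r with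
  | nil => exact ⟨rfl, HEq.rfl⟩
  | cons r e =>
    rename_i b
    rcases b with ⟨c, hc⟩ | _
    · exact (path_obs_base_elim (InPortionThree w) (.nv w) ⟨c, hc⟩ r).elim
    · cases y <;> exact (PEmpty.elim e : False).elim

end FromObs

/-! ## The two presentations of the embeddings agree -/

section Presentations

variable (v : Vmod)

/-- `embPlus` (abc-iut-L4-t3) and file 5's `plusEmb` agree on vertices. [cite: MochizukiAbsTopIII2015, Cor 5.5 (iii) p. 131] -/
theorem embPlus_obj_eq (a : (logShapePlus (isArc := isArc) v).Vertex) :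
    (embPlus (anJ (Vmod := Vmod) (isArc := isArc)) v).obj a = (plusEmb (Vmod := Vmod) (isArc := isArc) v).obj a := by
  cases a <;> rfl

/-- … and on paths. [cite: MochizukiAbsTopIII2015, Cor 5.5 (iii) p. 131] -/
theorem embPlus_mapPath_heq {a : (logShapePlus (isArc := isArc) v).Vertex} :
    ∀ {b : (logShapePlus (isArc := isArc) v).Vertex} (p : Path a b),
      HEq ((embPlus (anJ (Vmod := Vmod) (isArc := isArc)) v).mapPath p) ((plusEmb (Vmod := Vmod) (isArc := isArc) v).mapPath p)
  | _, Path.nil => heq_nil (embPlus_obj_eq v a)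
  | _, Path.cons (b := b) (c := c) p e => by
    rw [Prefunctor.mapPath_cons, Prefunctor.mapPath_cons]
    refine heq_cons (embPlus_obj_eq v a) (embPlus_obj_eq v b) (embPlus_obj_eq v c) (embPlus_mapPath_heq p) ?_
    cases b with
    | obs => cases c <;> exact (PEmpty.elim e)
    | base y =>
      cases c with
      | base z => rfl
      | obs => rfl

/-- `embTS` (abc-iut-L4-t3) and file 5's `tsEmb` agree on vertices. [cite: MochizukiAbsTopIII2015, Cor 5.5 (iii) p. 131] -/
theorem embTS_obj_eq (a : (logShapeTS (isArc := isArc) v).Vertex) :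
    (embTS (anJ (Vmod := Vmod) (isArc := isArc)) v).obj a = (tsEmb (Vmod := Vmod) (isArc := isArc) v).obj a := by
  cases a <;> rfl

/-- … and on paths. [cite: MochizukiAbsTopIII2015, Cor 5.5 (iii) p. 131] -/
theorem embTS_mapPath_heq {a : (logShapeTS (isArc := isArc) v).Vertex} :
    ∀ {b : (logShapeTS (isArc := isArc) v).Vertex} (p : Path a b),
      HEq ((embTS (anJ (Vmod := Vmod) (isArc := isArc)) v).mapPath p) ((tsEmb (Vmod := Vmod) (isArc := isArc) v).mapPath p)
  | _, Path.nil => heq_nil (embTS_obj_eq v a)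
  | _, Path.cons (b := b) (c := c) p e => by
    rw [Prefunctor.mapPath_cons, Prefunctor.mapPath_cons]
    refine heq_cons (embTS_obj_eq v a) (embTS_obj_eq v b) (embTS_obj_eq v c) (embTS_mapPath_heq p) ?_
    cases b with
    | obs => cases c <;> exact (PEmpty.elim e)
    | base y =>
      cases c with
      | base z => rfl
      | obs => rfl

/-- `D•_{≤4} ⊆ D•_{≤5}` (pointwise form). [cite: MochizukiAbsTopIII2015, Cor 5.5 p. 130] -/
theorem inFive_of_inFour' : ∀ ⦃a : DVertex Vmod isArc⦄, a.InFirstRows 4 → InFive (isArc := isArc) a :=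
  fun _ h => inFive_of_inFour h

/-- The inclusion `Γ⃗_{D•_{≤4} ∪ {ℰ•}} ↪ Γ⃗_{D_{An•}}` in file 1's presentation. [cite: MochizukiAbsTopIII2015, Cor 5.5 (iii) p. 131] -/
abbrev e5Emb : (obsShape (DVertex.InFirstRows (isArc := isArc) 4) DVertex.e5).Vertex ⥤q
    (anShape (Vmod := Vmod) (isArc := isArc)).Vertex :=
  embObs (DVertex.InFirstRows 4) .e5 inFive_of_inFour' e5_mem_five

/-- `embE5` (abc-iut-L4-t3) and `e5Emb` agree on vertices. [cite: MochizukiAbsTopIII2015, Cor 5.5 (iii) p. 131] -/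
theorem embE5_obj_eq (a : (obsShape (DVertex.InFirstRows (isArc := isArc) 4) DVertex.e5).Vertex) :
    (embE5 (anJ (Vmod := Vmod) (isArc := isArc))).obj a = e5Emb.obj a := by
  cases a <;> rfl

/-- … and on paths. [cite: MochizukiAbsTopIII2015, Cor 5.5 (iii) p. 131] -/
theorem embE5_mapPath_heq {a : (obsShape (DVertex.InFirstRows (isArc := isArc) 4) DVertex.e5).Vertex} :
    ∀ {b : (obsShape (DVertex.InFirstRows (isArc := isArc) 4) DVertex.e5).Vertex} (p : Path a b),
      HEq ((embE5 (anJ (Vmod := Vmod) (isArc := isArc))).mapPath p) (e5Emb.mapPath p)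
  | _, Path.nil => heq_nil (embE5_obj_eq a)
  | _, Path.cons (b := b) (c := c) p e => by
    rw [Prefunctor.mapPath_cons, Prefunctor.mapPath_cons]
    refine heq_cons (embE5_obj_eq a) (embE5_obj_eq b) (embE5_obj_eq c) (embE5_mapPath_heq p) ?_
    cases b with
    | obs => cases c <;> exact (PEmpty.elim e)
    | base y =>
      cases c with
      | base z => rfl
      | obs => rfl

/-- ★ The diagram of the core of (i) at `ℰ•` is `D_{An•}` pulled back along `e5Emb`. [cite: MochizukiAbsTopIII2015, Definition 3.5 (i) p.74] -/
theorem extendE5_eq_comapAlongAn :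
    (L.subdiagram (DVertex.InFirstRows 4)).extend (L.obsExt (DVertex.InFirstRows 4) .e5) = L.anDiagram.comapAlong e5Emb := by
  refine DiagramOfCategories.eq_comapAlong L.anDiagram e5Emb (fun a => ?_) (fun a => ?_) (fun {a b} e => ?_)
  · cases a <;> rfl
  · cases a <;> exact HEq.rfl
  · cases a with
    | base a =>
      cases b with
      | base b => exact HEq.rfl
      | obs => exact HEq.rfl
    | obs =>
      cases b with
      | base b => exact (PEmpty.elim e : False).elim
      | obs => exact (PEmpty.elim e : False).elim

end Presentations

end LogFrobeniusSetting

end Literature.AnabelianGeometry.AbsoluteAnabelian
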